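import Summits.AnomalousDissipation.AnomalousDissipation.Theorems.SawtoothPulseCascadeK1LocalisedCascadeHFibreCert

/-!
# K1loc explicit start, phase 1: THE PER-H-FIBRE CERTIFICATE, FLEXIBLE BASE LEVEL («HFibreCertFlex»)

Helper file of the prover lane on the crux `K1LocalisedCascade` (stmt-AnomalousDissipation-19491), route `SawtoothPulseCascade`
(arbiter A24-6 steps (3)–(5)).  `hfibre_cert_flex` is `…HFibreCert.hfibre_cert` with two relaxations needed by the fibres `p ≤ 51`,
whose tube `T_p` does not contain all eleven pieces: the base level `wc ≥ 0` is free (it must dominate `Uφ(m_c)` only when the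
central piece `|n| − 8p ∈ [−24,24]` meets `|n| ≥ 120`), and a side window `[n₁_k, n₂_k]` with `n₂_k < n₁_k` (empty) carries no weight
constraint.  The layer-cake proof is otherwise identical (pointwise `ω(p,n) ≤ wc + Σ_k w_k 𝟙_k(n)` on `T_p`, Parseval for the whole
fibre, `…HPieceBound.hpiece_le` for the flagged pieces).  No definitions; nothing about the crux.
[cite: Grafakos2014, Prop. 3.1.2 (5), Prop. 3.2.7 (3)] [problem: turb]
-/

-- `Summit.<Summit>.<Problem>`: single-conjunct summit, the duplicate namespace segment is deliberate.
set_option linter.dupNamespace false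
set_option maxRecDepth 4000

noncomputable section

namespace Summit.AnomalousDissipation.AnomalousDissipation.Theorems.SawtoothPulseCascade.K1Start

open MeasureTheory Filter Topology UnitAddTorus Complex AddCircle
open scoped Real
open Literature.Analysis Literature.Analysis.FunctionSpaces Literature.Analysis.FunctionSpaces.Torus Literature.Analysis.FluidPDE
open Literature.Analysis.FluidPDE.ShearStage
open Literature.Analysis.FluidPDE.SawtoothCascade Literature.Analysis.FluidPDE.SawtoothCascade.CascadeParams
open Summit.AnomalousDissipation.AnomalousDissipation.Theorems.SawtoothPulseCascade.K1Window

section Cascade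

variable (P : CascadeParams) (hγ : P.γ = 8) (hN₀ : P.N₀ = 1) (hρN : P.ρN = 2) (hd : P.d = 2) (hδ₀ : 0 < P.δ₀)
  (hδ₀' : P.δ₀ ≤ (2 : ℝ)⁻¹ ^ 30) (a b : ℕ → UnitAddTorus (Fin 2) → ℝ) (h0 : a 0 = datum)
  (hb : ∀ j, b j = a j ∘ shearMap 0 1 (amp ⟨P.U j, P.U_periodic j, P.contDiff_U (P.δ_pos hδ₀ (by rw [hd]; norm_num) j)⟩ P.γ))
  (hab : ∀ j, a (j + 1) = b j ∘ shearMap 1 0 (amp ⟨P.U j, P.U_periodic j, P.contDiff_U (P.δ_pos hδ₀ (by rw [hd]; norm_num) j)⟩ P.γ))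

include hγ hN₀ hρN hd hδ₀' h0 hb hab

/-- **Per-H-fibre certificate, flexible base level** (`p ≥ 0`; as `…HFibreCert.hfibre_cert`, but an empty central piece or an
empty side window imposes no weight constraint, and the base level `wc ≥ 0` is free): with the energy evaluation `e`, group evaluations `v`,
side-piece windows `[n₁_k, n₂_k]`, mass data `x, y, s` and flags, weights `wc, w` and totals `V⁰, ρ` as described in the file
header, `Σ_{n∈T_p} (467/45)φ(|n|)/ℓ · ‖𝓕b₁(p,n)‖² ≤ V⁰ + ρ·R_p`. [cite: Grafakos2014, Prop. 3.1.2 (5), Prop. 3.2.7 (3)] -/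
theorem hfibre_cert_flex (p : ℤ) (hp : 0 ≤ p) (e : ℝ) (v : Fin 6 → ℝ) (n₁ n₂ : Fin 10 → ℤ) (mc : ℤ)
    (x y s : Fin 10 → Fin 6 → ℝ) (flag : Fin 10 → Bool) (wc : ℝ) (w : Fin 10 → ℝ) (V0 ρ : ℝ)
    (he : ∑ i ∈ Finset.range 100, 2 * (1 / 2 * ((if ((i : ℤ) + 1) = 8 ∨ ((i : ℤ) + 1) = -8 then (1 / 2 : ℝ)
          else if ((i : ℤ) + 1) % 2 = 0 then 0 else 16 * 0.31831 / |64 - ((((i : ℤ) + 1 : ℤ)) : ℝ) ^ 2|) + (2 : ℝ)⁻¹ ^ 25) *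
        ((if 8 * ((i : ℤ) + 1) + (p + 1) = 0 ∨ 8 * ((i : ℤ) + 1) - (p + 1) = 0 then (1 / 2 : ℝ) else if (p + 1) % 2 = 0 then 0
            else 16 * |((((i : ℤ) + 1 : ℤ)) : ℝ)| * 0.31831 / |64 * ((((i : ℤ) + 1 : ℤ)) : ℝ) ^ 2 - ((p + 1 : ℤ) : ℝ) ^ 2|) +
          (if 8 * ((i : ℤ) + 1) + (p - 1) = 0 ∨ 8 * ((i : ℤ) + 1) - (p - 1) = 0 then (1 / 2 : ℝ) else if (p - 1) % 2 = 0 then 0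
            else 16 * |((((i : ℤ) + 1 : ℤ)) : ℝ)| * 0.31831 / |64 * ((((i : ℤ) + 1 : ℤ)) : ℝ) ^ 2 - ((p - 1 : ℤ) : ℝ) ^ 2|) +
          2 * |((((i : ℤ) + 1 : ℤ)) : ℝ)| * (2 : ℝ)⁻¹ ^ 25)) ^ 2 ≤ e)
    (hv : ∀ g : Fin 6, ∑ i ∈ Finset.range (((![4, 8, 14, 22, 36, 100] : Fin 6 → ℕ) g) - ((![0, 4, 8, 14, 22, 36] : Fin 6 → ℕ) g)), 2 * (1 / 2 * ((if ((((![0, 4, 8, 14, 22, 36] : Fin 6 → ℕ) g) : ℤ) + 1 + i) = 8 ∨ ((((![0, 4, 8, 14, 22, 36] : Fin 6 → ℕ) g) : ℤ) + 1 + i) = -8 then (1 / 2 : ℝ)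
          else if ((((![0, 4, 8, 14, 22, 36] : Fin 6 → ℕ) g) : ℤ) + 1 + i) % 2 = 0 then 0 else 16 * 0.31831 / |64 - ((((((![0, 4, 8, 14, 22, 36] : Fin 6 → ℕ) g) : ℤ) + 1 + i : ℤ)) : ℝ) ^ 2|) + (2 : ℝ)⁻¹ ^ 25) *
        ((if 8 * ((((![0, 4, 8, 14, 22, 36] : Fin 6 → ℕ) g) : ℤ) + 1 + i) + (p + 1) = 0 ∨ 8 * ((((![0, 4, 8, 14, 22, 36] : Fin 6 → ℕ) g) : ℤ) + 1 + i) - (p + 1) = 0 then (1 / 2 : ℝ) else if (p + 1) % 2 = 0 then 0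
            else 16 * |((((((![0, 4, 8, 14, 22, 36] : Fin 6 → ℕ) g) : ℤ) + 1 + i : ℤ)) : ℝ)| * 0.31831 / |64 * ((((((![0, 4, 8, 14, 22, 36] : Fin 6 → ℕ) g) : ℤ) + 1 + i : ℤ)) : ℝ) ^ 2 - ((p + 1 : ℤ) : ℝ) ^ 2|) +
          (if 8 * ((((![0, 4, 8, 14, 22, 36] : Fin 6 → ℕ) g) : ℤ) + 1 + i) + (p - 1) = 0 ∨ 8 * ((((![0, 4, 8, 14, 22, 36] : Fin 6 → ℕ) g) : ℤ) + 1 + i) - (p - 1) = 0 then (1 / 2 : ℝ) else if (p - 1) % 2 = 0 then 0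
            else 16 * |((((((![0, 4, 8, 14, 22, 36] : Fin 6 → ℕ) g) : ℤ) + 1 + i : ℤ)) : ℝ)| * 0.31831 / |64 * ((((((![0, 4, 8, 14, 22, 36] : Fin 6 → ℕ) g) : ℤ) + 1 + i : ℤ)) : ℝ) ^ 2 - ((p - 1 : ℤ) : ℝ) ^ 2|) +
          2 * |((((((![0, 4, 8, 14, 22, 36] : Fin 6 → ℕ) g) : ℤ) + 1 + i : ℤ)) : ℝ)| * (2 : ℝ)⁻¹ ^ 25)) ≤ v g)
    (hn : ∀ k : Fin 10, 120 ≤ n₁ k ∧ (n₁ k ≤ 120 ∨ n₁ k ≤ 8 * p + (![25, -56, 57, -140, 141, -200, 201, -290, 291, -399] : Fin 10 → ℤ) k) ∧ (3600 ≤ n₂ k ∨ 8 * p + (![56, -25, 140, -57, 200, -141, 290, -201, 399, -291] : Fin 10 → ℤ) k ≤ n₂ k))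
    (hmc : 120 ≤ mc ∧ (mc ≤ 120 ∨ mc + 24 ≤ 8 * p))
    (hflag : ∀ k : Fin 10, flag k = true → 1 ≤ p)
    (hmass : ∀ k : Fin 10, ∀ g : Fin 6, flag k = false ∨ ((1 ≤ s k g) ∨
      (0 ≤ x k g ∧ 0 ≤ y k g ∧ (n₁ k - ((![4, 8, 14, 22, 36, 100] : Fin 6 → ℕ) g) - 2) / 4 ≤ (n₂ k + ((![4, 8, 14, 22, 36, 100] : Fin 6 → ℕ) g) + 5) / 4 ∧
        4 * ((n₂ k + ((![4, 8, 14, 22, 36, 100] : Fin 6 → ℕ) g) + 5) / 4) < 8 * p ∧ 0 ≤ n₁ k - ((![4, 8, 14, 22, 36, 100] : Fin 6 → ℕ) g) - 2 ∧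
        1 / (8 * (p : ℝ) - 4 * (((n₂ k + ((![4, 8, 14, 22, 36, 100] : Fin 6 → ℕ) g) + 5) / 4 : ℤ) : ℝ)) -
          1 / (8 * (p : ℝ) - 4 * (((n₁ k - ((![4, 8, 14, 22, 36, 100] : Fin 6 → ℕ) g) - 2) / 4 : ℤ) : ℝ)) ≤ x k g ^ 2 ∧
        1 / (8 * (p : ℝ) + 4 * (((n₁ k - ((![4, 8, 14, 22, 36, 100] : Fin 6 → ℕ) g) - 2) / 4 : ℤ) : ℝ)) -
          1 / (8 * (p : ℝ) + 4 * (((n₂ k + ((![4, 8, 14, 22, 36, 100] : Fin 6 → ℕ) g) + 5) / 4 : ℤ) : ℝ)) ≤ y k g ^ 2 ∧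
        0.3184 * (x k g + y k g) ≤ s k g) ∨
      (0 ≤ s k g ∧ (n₁ k - ((![4, 8, 14, 22, 36, 100] : Fin 6 → ℕ) g) - 2) / 4 ≤ (n₂ k + ((![4, 8, 14, 22, 36, 100] : Fin 6 → ℕ) g) + 5) / 4 ∧
        8 * p < 4 * ((n₁ k - ((![4, 8, 14, 22, 36, 100] : Fin 6 → ℕ) g) - 2) / 4) ∧
        0.101322 * (1 / (4 * (((n₁ k - ((![4, 8, 14, 22, 36, 100] : Fin 6 → ℕ) g) - 2) / 4 : ℤ) : ℝ) - 8 * p) -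
          1 / (4 * (((n₂ k + ((![4, 8, 14, 22, 36, 100] : Fin 6 → ℕ) g) + 5) / 4 : ℤ) : ℝ) - 8 * p)) ≤ s k g ^ 2)))
    (hwc : 0 ≤ wc ∧ (8 * p + 24 < 120 ∨
      467 / 45 * (if ((mc : ℤ) : ℝ) < 200 then 0.0396607 / (((mc : ℤ) : ℝ) - 108.5) else 0.0768758 / (((mc : ℤ) : ℝ) - 22)) ≤ wc))
    (hw : ∀ k : Fin 10, 0 ≤ w k ∧ (n₂ k < n₁ k ∨ 467 / 45 * (if ((n₁ k : ℤ) : ℝ) < 200 then 0.0396607 / (((n₁ k : ℤ) : ℝ) - 108.5) else 0.0768758 / (((n₁ k : ℤ) : ℝ) - 22)) * (![5 / 2, 5 / 2, 9, 9, 9, 9, 9, 9, 9, 9] : Fin 10 → ℝ) k - wc ≤ w k))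
    (hV0 : wc * e + ∑ k : Fin 10, w k * (if flag k = true then 5 / 2 * (∑ g : Fin 6, v g * (s k g + (2 : ℝ)⁻¹ ^ 27 * p)) ^ 2 else e) ≤ V0)
    (hρ : wc + ∑ k : Fin 10, w k * (if flag k = true then (10 : ℝ) else 1) ≤ ρ) :
    ∑ n ∈ ((Finset.Icc (-3600 : ℤ) 3600).filter (fun n => 120 ≤ |n|)).filter (fun n => |(8 * |p| - |n|)| < 400),
      467 / 45 * (if ((|n|) : ℝ) < 200 then 0.0396607 / (((|n|) : ℝ) - 108.5) else 0.0768758 / (((|n|) : ℝ) - 22)) / (if |(|n| - 8 * |p|)| ≤ 24 then (1 : ℝ) else if |(|n| - 8 * |p|)| ≤ 56 then 2 / 5 else 1 / 9) * ‖mFourierCoeff (fun x => (b 1 x : ℂ)) ![p, n]‖ ^ 2 ≤ V0 + ρ * ∑' q : ℤ, (if q ∈ (Finset.Icc (-(100 : ℤ)) 100).filter (fun q => 1 ≤ |q|) then 0 else ‖mFourierCoeff (fun x => (a 1 x : ℂ)) ![p, q]‖ ^ 2) := by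
  classical
  have hd' : 0 < P.d := by rw [hd]; norm_num
  have hp' : |p| = p := abs_of_nonneg hp
  set S : Finset ℤ := (Finset.Icc (-(100 : ℤ)) 100).filter (fun q => 1 ≤ |q|) with hS
  set R : ℝ := ∑' q : ℤ, (if q ∈ (Finset.Icc (-(100 : ℤ)) 100).filter (fun q => 1 ≤ |q|) then 0 else ‖mFourierCoeff (fun x => (a 1 x : ℂ)) ![p, q]‖ ^ 2) with hRdef
  have hR0 : 0 ≤ R := tsum_nonneg fun q => by split_ifs <;> positivity
  obtain ⟨T, hT⟩ : ∃ T : Finset ℤ, T = ((Finset.Icc (-3600 : ℤ) 3600).filter (fun n => 120 ≤ |n|)).filter (fun n => |(8 * |p| - |n|)| < 400) := ⟨_, rfl⟩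
  rw [← hT]
  obtain ⟨c, hc⟩ : ∃ c : ℤ → ℝ, ∀ n, c n = ‖mFourierCoeff (fun x => (b 1 x : ℂ)) ![p, n]‖ ^ 2 := ⟨_, fun _ => rfl⟩
  have hc0 : ∀ n, 0 ≤ c n := fun n => by rw [hc]; exact sq_nonneg _
  simp only [← hc]
  -- §a energies: whole fibre and pieces
  have he' := phaseOne_energy_le_eval P hγ hN₀ hδ₀ hδ₀' hd' a b h0 (hb 0) (hab 0) p 100 he
  push_cast at he'
  have htot : ∑ n ∈ T, c n ≤ e + R := by
    have h := hfibre_total_le P hd hδ₀ a b h0 hb hab p T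
    simp only [← hc] at h
    rw [← hRdef] at h
    linarith
  have hQ : ∀ g : Fin 6, (![0, 4, 8, 14, 22, 36] : Fin 6 → ℕ) g ≤ (![4, 8, 14, 22, 36, 100] : Fin 6 → ℕ) g ∧
      (![4, 8, 14, 22, 36, 100] : Fin 6 → ℕ) g ≤ 100 := by decide
  have hpiece : ∀ k : Fin 10, ∑ n ∈ T.filter (fun n => n₁ k ≤ |n| ∧ |n| ≤ n₂ k), c n ≤
      (if flag k = true then 5 / 2 * (∑ g : Fin 6, v g * (s k g + (2 : ℝ)⁻¹ ^ 27 * p)) ^ 2 else e) +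
        (if flag k = true then (10 : ℝ) else 1) * R := by
    intro k
    cases hfk : flag k
    · simp only [Bool.false_eq_true, if_false, one_mul]
      exact (Finset.sum_le_sum_of_subset_of_nonneg (Finset.filter_subset _ T) fun n _ _ => hc0 n).trans htot
    · simp only [if_true]
      have hp1 : 1 ≤ p := hflag k hfk
      have hv' : ∀ g : Fin 6, ∑ q ∈ S.filter (fun q => (((![0, 4, 8, 14, 22, 36] : Fin 6 → ℕ) g : ℕ) : ℤ) < |q| ∧
          |q| ≤ (((![4, 8, 14, 22, 36, 100] : Fin 6 → ℕ) g : ℕ) : ℤ)), ‖mFourierCoeff (fun x => (a 1 x : ℂ)) ![p, q]‖ ≤ v g :=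
        fun g => phaseOne_group_le_eval P hγ hN₀ hδ₀ hδ₀' hd' a b h0 (hb 0) (hab 0) p (hQ g).1 (hQ g).2 (hv g)
      have hm' : ∀ g : Fin 6, (1 ≤ s k g) ∨
      (0 ≤ x k g ∧ 0 ≤ y k g ∧ (n₁ k - ((![4, 8, 14, 22, 36, 100] : Fin 6 → ℕ) g) - 2) / 4 ≤ (n₂ k + ((![4, 8, 14, 22, 36, 100] : Fin 6 → ℕ) g) + 5) / 4 ∧
        4 * ((n₂ k + ((![4, 8, 14, 22, 36, 100] : Fin 6 → ℕ) g) + 5) / 4) < 8 * p ∧ 0 ≤ n₁ k - ((![4, 8, 14, 22, 36, 100] : Fin 6 → ℕ) g) - 2 ∧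
        1 / (8 * (p : ℝ) - 4 * (((n₂ k + ((![4, 8, 14, 22, 36, 100] : Fin 6 → ℕ) g) + 5) / 4 : ℤ) : ℝ)) -
          1 / (8 * (p : ℝ) - 4 * (((n₁ k - ((![4, 8, 14, 22, 36, 100] : Fin 6 → ℕ) g) - 2) / 4 : ℤ) : ℝ)) ≤ x k g ^ 2 ∧
        1 / (8 * (p : ℝ) + 4 * (((n₁ k - ((![4, 8, 14, 22, 36, 100] : Fin 6 → ℕ) g) - 2) / 4 : ℤ) : ℝ)) -
          1 / (8 * (p : ℝ) + 4 * (((n₂ k + ((![4, 8, 14, 22, 36, 100] : Fin 6 → ℕ) g) + 5) / 4 : ℤ) : ℝ)) ≤ y k g ^ 2 ∧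
        0.3184 * (x k g + y k g) ≤ s k g) ∨
      (0 ≤ s k g ∧ (n₁ k - ((![4, 8, 14, 22, 36, 100] : Fin 6 → ℕ) g) - 2) / 4 ≤ (n₂ k + ((![4, 8, 14, 22, 36, 100] : Fin 6 → ℕ) g) + 5) / 4 ∧
        8 * p < 4 * ((n₁ k - ((![4, 8, 14, 22, 36, 100] : Fin 6 → ℕ) g) - 2) / 4) ∧
        0.101322 * (1 / (4 * (((n₁ k - ((![4, 8, 14, 22, 36, 100] : Fin 6 → ℕ) g) - 2) / 4 : ℤ) : ℝ) - 8 * p) -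
          1 / (4 * (((n₂ k + ((![4, 8, 14, 22, 36, 100] : Fin 6 → ℕ) g) + 5) / 4 : ℤ) : ℝ) - 8 * p)) ≤ s k g ^ 2) := fun g => (hmass k g).resolve_left (by simp [hfk])
      have h := hpiece_le P hγ hN₀ hρN hd hδ₀ hδ₀' a b h0 hb hab p hp1 (n₁ k) (n₂ k) (by linarith [(hn k).1])
        v (x k) (y k) (s k) hv' hm' T
      simp only [← hc] at h
      exact h
  -- §b the pointwise weight bound (layer cake over the pieces)
  have hφle : ∀ n m : ℤ, 120 ≤ m → m ≤ |n| →
      (if |(n : ℝ)| < 200 then 0.0396607 / (|(n : ℝ)| - 108.5) else 0.0768758 / (|(n : ℝ)| - 22) : ℝ) ≤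
        (if ((m : ℤ) : ℝ) < 200 then 0.0396607 / (((m : ℤ) : ℝ) - 108.5) else 0.0768758 / (((m : ℤ) : ℝ) - 22)) :=
    fun n m hm hmn => phiV_antitone (by exact_mod_cast hm) (by exact_mod_cast hmn)
  have hφ0 : ∀ n : ℤ, 120 ≤ |n| →
      0 ≤ (if |(n : ℝ)| < 200 then 0.0396607 / (|(n : ℝ)| - 108.5) else 0.0768758 / (|(n : ℝ)| - 22) : ℝ) :=
    fun n hn => (phiV_pos (by exact_mod_cast hn)).le
  have hind0 : ∀ (n : ℤ) (k : Fin 10), 0 ≤ w k * (if n₁ k ≤ |n| ∧ |n| ≤ n₂ k then (1 : ℝ) else 0) :=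
    fun n k => mul_nonneg (hw k).1 (by split_ifs <;> norm_num)
  have hS0 : ∀ n : ℤ, 0 ≤ ∑ k : Fin 10, w k * (if n₁ k ≤ |n| ∧ |n| ≤ n₂ k then (1 : ℝ) else 0) :=
    fun n => Finset.sum_nonneg fun k _ => hind0 n k
  have hS1 : ∀ (n : ℤ) (k₀ : Fin 10), (n₁ k₀ ≤ |n| ∧ |n| ≤ n₂ k₀) →
      w k₀ ≤ ∑ k : Fin 10, w k * (if n₁ k ≤ |n| ∧ |n| ≤ n₂ k then (1 : ℝ) else 0) := by
    intro n k₀ h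
    calc w k₀ = w k₀ * (if n₁ k₀ ≤ |n| ∧ |n| ≤ n₂ k₀ then (1 : ℝ) else 0) := by rw [if_pos h, mul_one]
      _ ≤ _ := Finset.single_le_sum (fun k _ => hind0 n k) (Finset.mem_univ k₀)
  have hIL : ∀ k : Fin 10, 0 ≤ (![5 / 2, 5 / 2, 9, 9, 9, 9, 9, 9, 9, 9] : Fin 10 → ℝ) k := by
    intro k; fin_cases k <;> norm_num
  have hwc0 : 0 ≤ wc := hwc.1
  -- one piece: if `n ∈ T` lies in the window of piece `k` then `Uφ(|n|)·IL_k ≤ wc + Σ_k w_k 𝟙_k(n)`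
  have hcase : ∀ n : ℤ, 120 ≤ |n| → ∀ k : Fin 10, n₁ k ≤ |n| → |n| ≤ n₂ k →
      467 / 45 * (if |(n : ℝ)| < 200 then 0.0396607 / (|(n : ℝ)| - 108.5) else 0.0768758 / (|(n : ℝ)| - 22) : ℝ) * (![5 / 2, 5 / 2, 9, 9, 9, 9, 9, 9, 9, 9] : Fin 10 → ℝ) k ≤
        wc + ∑ k : Fin 10, w k * (if n₁ k ≤ |n| ∧ |n| ≤ n₂ k then (1 : ℝ) else 0) := by
    intro n hn120 k hk1 hk2
    have h1 := hφle n (n₁ k) (hn k).1 hk1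
    have h2 := hS1 n k ⟨hk1, hk2⟩
    have h3 := (hw k).2.resolve_left (by omega)
    have h4 : 467 / 45 * (if |(n : ℝ)| < 200 then 0.0396607 / (|(n : ℝ)| - 108.5) else 0.0768758 / (|(n : ℝ)| - 22) : ℝ) * (![5 / 2, 5 / 2, 9, 9, 9, 9, 9, 9, 9, 9] : Fin 10 → ℝ) k ≤
        467 / 45 * (if (((n₁ k) : ℤ) : ℝ) < 200 then 0.0396607 / ((((n₁ k) : ℤ) : ℝ) - 108.5)
          else 0.0768758 / ((((n₁ k) : ℤ) : ℝ) - 22)) * (![5 / 2, 5 / 2, 9, 9, 9, 9, 9, 9, 9, 9] : Fin 10 → ℝ) k :=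
      mul_le_mul_of_nonneg_right (mul_le_mul_of_nonneg_left h1 (by norm_num)) (hIL k)
    linarith
  have hpt : ∀ n ∈ T, 467 / 45 * (if |(n : ℝ)| < 200 then 0.0396607 / (|(n : ℝ)| - 108.5) else 0.0768758 / (|(n : ℝ)| - 22) : ℝ) / (if |(|n| - 8 * |p|)| ≤ 24 then (1 : ℝ) else if |(|n| - 8 * |p|)| ≤ 56 then 2 / 5 else 1 / 9) ≤
      wc + ∑ k : Fin 10, w k * (if n₁ k ≤ |n| ∧ |n| ≤ n₂ k then (1 : ℝ) else 0) := by
    intro n hnT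
    rw [hT, Finset.mem_filter, Finset.mem_filter, Finset.mem_Icc, hp'] at hnT
    obtain ⟨⟨hn36, hn120⟩, htube⟩ := hnT
    have hnle : |n| ≤ 3600 := abs_le.2 ⟨hn36.1, hn36.2⟩
    have htube' := abs_lt.1 htube
    have ha1 := abs_choice (|n| - 8 * p); have ha2 := abs_nonneg (|n| - 8 * p)
    rw [hp']
    have hφn := hφ0 n hn120
    -- the eleven pieces of the tube
    have hsplit : |(|n| - 8 * p)| ≤ 24 ∨ (25 ≤ |n| - 8 * p ∧ |n| - 8 * p ≤ 56) ∨ (-56 ≤ |n| - 8 * p ∧ |n| - 8 * p ≤ -25) ∨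
        (57 ≤ |n| - 8 * p ∧ |n| - 8 * p ≤ 140) ∨ (-140 ≤ |n| - 8 * p ∧ |n| - 8 * p ≤ -57) ∨
        (141 ≤ |n| - 8 * p ∧ |n| - 8 * p ≤ 200) ∨ (-200 ≤ |n| - 8 * p ∧ |n| - 8 * p ≤ -141) ∨
        (201 ≤ |n| - 8 * p ∧ |n| - 8 * p ≤ 290) ∨ (-290 ≤ |n| - 8 * p ∧ |n| - 8 * p ≤ -201) ∨
        (291 ≤ |n| - 8 * p ∧ |n| - 8 * p ≤ 399) ∨ (-399 ≤ |n| - 8 * p ∧ |n| - 8 * p ≤ -291) := by omega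
    rcases hsplit with h | h | h | h | h | h | h | h | h | h | h
    · -- central piece: `ℓ = 1`, `φ(|n|) ≤ φ(mc) `
      rw [if_pos h, div_one]
      have h1 := hφle n mc hmc.1 (by rcases hmc.2 with h' | h' <;> omega)
      have h2 := hwc.2.resolve_left (by omega)
      linarith [hS0 n]
    · -- piece 0: `|n| − 8p ∈ [25, 56]`, level `2/5`
      have h24 : ¬ |(|n| - 8 * p)| ≤ 24 := by omega
      have h56 : |(|n| - 8 * p)| ≤ 56 := by omega
      rw [if_neg h24, if_pos h56]
      have hnk := hn 0; simp only [Fin.isValue, Matrix.cons_val] at hnk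
      have hc' := hcase n hn120 0 (by omega) (by omega); simp only [Fin.isValue, Matrix.cons_val] at hc'
      exact le_trans (le_of_eq (by ring)) hc'
    · -- piece 1: `|n| − 8p ∈ [-56, -25]`, level `2/5`
      have h24 : ¬ |(|n| - 8 * p)| ≤ 24 := by omega
      have h56 : |(|n| - 8 * p)| ≤ 56 := by omega
      rw [if_neg h24, if_pos h56]
      have hnk := hn 1; simp only [Fin.isValue, Matrix.cons_val] at hnk
      have hc' := hcase n hn120 1 (by omega) (by omega); simp only [Fin.isValue, Matrix.cons_val] at hc'
      exact le_trans (le_of_eq (by ring)) hc'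
    · -- piece 2: `|n| − 8p ∈ [57, 140]`, level `1/9`
      have h24 : ¬ |(|n| - 8 * p)| ≤ 24 := by omega
      have h56 : ¬ |(|n| - 8 * p)| ≤ 56 := by omega
      rw [if_neg h24, if_neg h56]
      have hnk := hn 2; simp only [Fin.isValue, Matrix.cons_val] at hnk
      have hc' := hcase n hn120 2 (by omega) (by omega); simp only [Fin.isValue, Matrix.cons_val] at hc'
      exact le_trans (le_of_eq (by ring)) hc'
    · -- piece 3: `|n| − 8p ∈ [-140, -57]`, level `1/9`
      have h24 : ¬ |(|n| - 8 * p)| ≤ 24 := by omega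
      have h56 : ¬ |(|n| - 8 * p)| ≤ 56 := by omega
      rw [if_neg h24, if_neg h56]
      have hnk := hn 3; simp only [Fin.isValue, Matrix.cons_val] at hnk
      have hc' := hcase n hn120 3 (by omega) (by omega); simp only [Fin.isValue, Matrix.cons_val] at hc'
      exact le_trans (le_of_eq (by ring)) hc'
    · -- piece 4: `|n| − 8p ∈ [141, 200]`, level `1/9`
      have h24 : ¬ |(|n| - 8 * p)| ≤ 24 := by omega
      have h56 : ¬ |(|n| - 8 * p)| ≤ 56 := by omega
      rw [if_neg h24, if_neg h56]
      have hnk := hn 4; simp only [Fin.isValue, Matrix.cons_val] at hnk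
      have hc' := hcase n hn120 4 (by omega) (by omega); simp only [Fin.isValue, Matrix.cons_val] at hc'
      exact le_trans (le_of_eq (by ring)) hc'
    · -- piece 5: `|n| − 8p ∈ [-200, -141]`, level `1/9`
      have h24 : ¬ |(|n| - 8 * p)| ≤ 24 := by omega
      have h56 : ¬ |(|n| - 8 * p)| ≤ 56 := by omega
      rw [if_neg h24, if_neg h56]
      have hnk := hn 5; simp only [Fin.isValue, Matrix.cons_val] at hnk
      have hc' := hcase n hn120 5 (by omega) (by omega); simp only [Fin.isValue, Matrix.cons_val] at hc'
      exact le_trans (le_of_eq (by ring)) hc'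
    · -- piece 6: `|n| − 8p ∈ [201, 290]`, level `1/9`
      have h24 : ¬ |(|n| - 8 * p)| ≤ 24 := by omega
      have h56 : ¬ |(|n| - 8 * p)| ≤ 56 := by omega
      rw [if_neg h24, if_neg h56]
      have hnk := hn 6; simp only [Fin.isValue, Matrix.cons_val] at hnk
      have hc' := hcase n hn120 6 (by omega) (by omega); simp only [Fin.isValue, Matrix.cons_val] at hc'
      exact le_trans (le_of_eq (by ring)) hc'
    · -- piece 7: `|n| − 8p ∈ [-290, -201]`, level `1/9`
      have h24 : ¬ |(|n| - 8 * p)| ≤ 24 := by omega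
      have h56 : ¬ |(|n| - 8 * p)| ≤ 56 := by omega
      rw [if_neg h24, if_neg h56]
      have hnk := hn 7; simp only [Fin.isValue, Matrix.cons_val] at hnk
      have hc' := hcase n hn120 7 (by omega) (by omega); simp only [Fin.isValue, Matrix.cons_val] at hc'
      exact le_trans (le_of_eq (by ring)) hc'
    · -- piece 8: `|n| − 8p ∈ [291, 399]`, level `1/9`
      have h24 : ¬ |(|n| - 8 * p)| ≤ 24 := by omega
      have h56 : ¬ |(|n| - 8 * p)| ≤ 56 := by omega
      rw [if_neg h24, if_neg h56]
      have hnk := hn 8; simp only [Fin.isValue, Matrix.cons_val] at hnk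
      have hc' := hcase n hn120 8 (by omega) (by omega); simp only [Fin.isValue, Matrix.cons_val] at hc'
      exact le_trans (le_of_eq (by ring)) hc'
    · -- piece 9: `|n| − 8p ∈ [-399, -291]`, level `1/9`
      have h24 : ¬ |(|n| - 8 * p)| ≤ 24 := by omega
      have h56 : ¬ |(|n| - 8 * p)| ≤ 56 := by omega
      rw [if_neg h24, if_neg h56]
      have hnk := hn 9; simp only [Fin.isValue, Matrix.cons_val] at hnk
      have hc' := hcase n hn120 9 (by omega) (by omega); simp only [Fin.isValue, Matrix.cons_val] at hc'
      exact le_trans (le_of_eq (by ring)) hc'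

  -- §c summation
  have hmain : ∑ n ∈ T, 467 / 45 * (if |(n : ℝ)| < 200 then 0.0396607 / (|(n : ℝ)| - 108.5) else 0.0768758 / (|(n : ℝ)| - 22) : ℝ) / (if |(|n| - 8 * |p|)| ≤ 24 then (1 : ℝ) else if |(|n| - 8 * |p|)| ≤ 56 then 2 / 5 else 1 / 9) * c n ≤
      ∑ n ∈ T, (wc + ∑ k : Fin 10, w k * (if n₁ k ≤ |n| ∧ |n| ≤ n₂ k then (1 : ℝ) else 0)) * c n :=
    Finset.sum_le_sum fun n hn => mul_le_mul_of_nonneg_right (hpt n hn) (hc0 n)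
  have hexp : ∑ n ∈ T, (wc + ∑ k : Fin 10, w k * (if n₁ k ≤ |n| ∧ |n| ≤ n₂ k then (1 : ℝ) else 0)) * c n =
      wc * ∑ n ∈ T, c n + ∑ k : Fin 10, w k * ∑ n ∈ T.filter (fun n => n₁ k ≤ |n| ∧ |n| ≤ n₂ k), c n := by
    have e1 : ∀ n ∈ T, (wc + ∑ k : Fin 10, w k * (if n₁ k ≤ |n| ∧ |n| ≤ n₂ k then (1 : ℝ) else 0)) * c n =
        wc * c n + ∑ k : Fin 10, w k * ((if n₁ k ≤ |n| ∧ |n| ≤ n₂ k then (1 : ℝ) else 0) * c n) := by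
      intro n _
      rw [add_mul, Finset.sum_mul]
      congr 1
      exact Finset.sum_congr rfl fun k _ => by ring
    have e2 := Finset.sum_congr rfl e1
    have e3 : ∑ n ∈ T, (wc * c n + ∑ k : Fin 10, w k * ((if n₁ k ≤ |n| ∧ |n| ≤ n₂ k then (1 : ℝ) else 0) * c n)) =
        ∑ n ∈ T, wc * c n + ∑ n ∈ T, ∑ k : Fin 10, w k * ((if n₁ k ≤ |n| ∧ |n| ≤ n₂ k then (1 : ℝ) else 0) * c n) :=
      Finset.sum_add_distrib
    have e4 : ∑ n ∈ T, wc * c n = wc * ∑ n ∈ T, c n := (Finset.mul_sum _ _ _).symm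
    have e5 : ∑ n ∈ T, ∑ k : Fin 10, w k * ((if n₁ k ≤ |n| ∧ |n| ≤ n₂ k then (1 : ℝ) else 0) * c n) =
        ∑ k : Fin 10, ∑ n ∈ T, w k * ((if n₁ k ≤ |n| ∧ |n| ≤ n₂ k then (1 : ℝ) else 0) * c n) := Finset.sum_comm
    have e6 : ∀ k : Fin 10, ∑ n ∈ T, w k * ((if n₁ k ≤ |n| ∧ |n| ≤ n₂ k then (1 : ℝ) else 0) * c n) =
        w k * ∑ n ∈ T.filter (fun n => n₁ k ≤ |n| ∧ |n| ≤ n₂ k), c n := by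
      intro k
      rw [Finset.mul_sum, Finset.sum_filter]
      exact Finset.sum_congr rfl fun n _ => by split_ifs <;> simp
    rw [e2, e3, e4, e5, Finset.sum_congr rfl fun k _ => e6 k]
  have hsum2 : ∑ k : Fin 10, w k * ∑ n ∈ T.filter (fun n => n₁ k ≤ |n| ∧ |n| ≤ n₂ k), c n ≤
      ∑ k : Fin 10, w k * ((if flag k = true then 5 / 2 * (∑ g : Fin 6, v g * (s k g + (2 : ℝ)⁻¹ ^ 27 * p)) ^ 2 else e) +
        (if flag k = true then (10 : ℝ) else 1) * R) :=
    Finset.sum_le_sum fun k _ => mul_le_mul_of_nonneg_left (hpiece k) (hw k).1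
  have halg : ∑ k : Fin 10, w k * ((if flag k = true then 5 / 2 * (∑ g : Fin 6, v g * (s k g + (2 : ℝ)⁻¹ ^ 27 * p)) ^ 2 else e) +
        (if flag k = true then (10 : ℝ) else 1) * R) =
      ∑ k : Fin 10, w k * (if flag k = true then 5 / 2 * (∑ g : Fin 6, v g * (s k g + (2 : ℝ)⁻¹ ^ 27 * p)) ^ 2 else e) +
        (∑ k : Fin 10, w k * (if flag k = true then (10 : ℝ) else 1)) * R := by
    rw [Finset.sum_mul, ← Finset.sum_add_distrib]
    refine Finset.sum_congr rfl fun k _ => ?_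
    ring
  have hρR : (wc + ∑ k : Fin 10, w k * (if flag k = true then (10 : ℝ) else 1)) * R ≤ ρ * R :=
    mul_le_mul_of_nonneg_right hρ hR0
  calc ∑ n ∈ T, 467 / 45 * (if |(n : ℝ)| < 200 then 0.0396607 / (|(n : ℝ)| - 108.5) else 0.0768758 / (|(n : ℝ)| - 22) : ℝ) / (if |(|n| - 8 * |p|)| ≤ 24 then (1 : ℝ) else if |(|n| - 8 * |p|)| ≤ 56 then 2 / 5 else 1 / 9) * c n
      ≤ wc * ∑ n ∈ T, c n + ∑ k : Fin 10, w k * ∑ n ∈ T.filter (fun n => n₁ k ≤ |n| ∧ |n| ≤ n₂ k), c n := by rw [← hexp]; exact hmain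
    _ ≤ wc * (e + R) + (∑ k : Fin 10, w k * (if flag k = true then 5 / 2 * (∑ g : Fin 6, v g * (s k g + (2 : ℝ)⁻¹ ^ 27 * p)) ^ 2 else e) +
        (∑ k : Fin 10, w k * (if flag k = true then (10 : ℝ) else 1)) * R) := by
          rw [← halg]; exact add_le_add (mul_le_mul_of_nonneg_left htot hwc0) hsum2
    _ = (wc * e + ∑ k : Fin 10, w k * (if flag k = true then 5 / 2 * (∑ g : Fin 6, v g * (s k g + (2 : ℝ)⁻¹ ^ 27 * p)) ^ 2 else e)) +
        (wc + ∑ k : Fin 10, w k * (if flag k = true then (10 : ℝ) else 1)) * R := by ring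
    _ ≤ V0 + ρ * R := add_le_add hV0 hρR

end Cascade

end Summit.AnomalousDissipation.AnomalousDissipation.Theorems.SawtoothPulseCascade.K1Start
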